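import Summits.BirchSwinnertonDyer.BirchSwinnertonDyer.Theses.VerticalContact

/-!
# Disproof of `VerticalContact` (stmt-BirchSwinnertonDyer-18431) — findings of the crux disprover

Unit `cdisprove-stmt-BirchSwinnertonDyer-18431`, cycle 1 (2026-08-17).  Prose lives in docstrings;
every `theorem` below is sorry-free and `lean check`ed.  Sections:

* §0  Verdict so far.  NO KILL of the mathematics.  The decl AS TYPED is conjecturally false for a
      reason unrelated to the contact order (D1, quantifier order: the coefficient field `F` — with
      `𝔓, ι, e, e'` — is bound BEFORE `∀ N`, so one number field must contain the Hecke fields of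
      `p`-ordinary non-CM eigenforms of weights `k_N ≥ 2 + 2(p-1)p^N → ∞`; Hida, JAMS 24 (2011)
      Conj. 8.1 / Hida 2016).  Five seats filed this before me (item notes 05:25Z, 11:48Z; evidence
      OBJECTION / CRUX-ATTACK / Repair.lean / PICKED.md); it is not Lean-refutable (no Jacquet–Langlands,
      no Galois representations of eigenforms in the tree), so no `¬ VerticalContact` is landed and the
      planner's restate (`Census.VerticalContactR`, `Cruxes/VerticalContact/CensusSketch.lean`) is the fix.
      Everything below is stated so that it applies verbatim to the REPAIRED statement.
* §1  Load-bearing analysis of the depth clause (theorems `bound_forces_period_ne_zero`,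
      `period_ne_zero_imp_exists_value_ne_zero`): the bound clause forces `P_N ≠ 0`, hence the
      conjunct `∃ I ∈ RI, PT I ∧ Φ I ≠ 0` of the form clause is REDUNDANT (implied by the bound via
      `HG (L c) ∧ PT (L c)`), and any witness must in particular prove NON-VANISHING of the typed toric
      period at every depth — a Greenberg/Cornut–Vatsal-type generic non-vanishing along the slanted arc
      `(k, ξ_k)`, itself open (census §Decomposition, `Sub₁`).
* §2  What resists, and why (docstring `resists`): in the BSD-relevant configuration `(2s, 0)` a
      counterexample needs `s⁺(E,p) > r_an(E)` at every admissible `p` (¬Selmer-UB) or a universal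
      degeneracy `Pf(A⁺_p) = 0` of the alternating weight height; neither has a mechanism.  No junk /
      degenerate instance of the typed data is available: `W` must be globally minimal elliptic with a
      multiplicative prime, all side conditions are genuine tree notions (conductor via Ogg/Tate,
      `analyticRank` via the entire continuation, surjectivity on `E[p](ℚ̄)`), and the Hecke clause uses
      the sub-lattice `T_q` whose eigenvalue is the ARITHMETIC `a_q(g_k)` (checked numerically: the
      `T_p`-eigenvalue of the ordinary form is a unit, §3), so `val (lam p) = 1` is satisfiable.
* §3  THE CHEAPEST FALSIFIER, RUN (route KILL CRITERIA / census falsifiers 1–3): a weight-`k` Brandt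
      module for `B_{ℓ,∞}` (ℓ = 19, 37, 389) with the typed twisted Gross period, built this cycle
      (`job/qalg.py`, `job/symk.py`, `job/main.py`, attached as evidence; kit job ids in the table).
      Exact local results (pure Python, precision `5^20`–`5^30`):
        - 19a1 (r_an = 0), p = 5, K = ℚ(√-11): weight-2 Gross period `P₂ = 1 ≠ 0` (L(E/K,1) ≠ 0);
          k = 10 (N = 0): `v(P) - content = 0`; k = 42 (N = 1): `0`.            ⇒ bounded, m = 0 ✓.
        - 37a1 (r_an = 1, configuration (1,1), r̃_an = 2), p = 5, K = ℚ(√-19): `P₂ = 0` ✓;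
          k = 10 (N = 0): `v(P_typed) = 1`, content 0 ⇒ `2(v - content) = 2`;
          k = 42 (N = 1): `v(P_typed) = 2`            ⇒ `2(v - content) = 4`;
          i.e. EXACTLY the line `2m(N+1)` with `m = 1`: the crux's bound is attained with `C = 0` so far
          (tightness), and the congruence lower bound `v ≥ N+1` is also attained (contact order exactly 1).
          The norm-type (trivial-character, Longo–Vigni `𝓙₀`) component is `≡ 0` to full precision at
          both weights — census defect D2 ("narrated period vanishes identically for odd rank") CONFIRMED.
        - congruence depths of the isolated ordinary eigenform: `v(λ_q - a_q(E)) = N+1` for q = 2, 3 and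
          `= 1` for q = p (as it must: `a_p(E) - α_E = p/α_E`), `v(λ_p) = 0` (ordinary; this also pins the
          Hecke normalisation: the sub-lattice `T_p` of the decl has the unit eigenvalue).
      Pending on the compute farm (job j026225): 37a1 at N = 2, 3 (k = 202, 1002); 389a1 (r_an = 2,
      configuration (2,0), the first BSD-relevant open cell) at p = 7 (k = 14, 38, 86), p = 5 (k = 26,
      122), p = 11 (k = 22).  KILL SIGNAL would be slope ≥ 2 per depth for 389a1 at two admissible (p, K).
* §1b D3 (NEW): CHARACTER LEAKAGE — admissible weights with `(p-1)p^N ∤ (k-2)/hK` (possible iff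
      `gcd(hK, p-1) > 1`) make the typed period a `χ`-TWISTED Gross period (`χ ≠ 𝟙` on `Pic 𝓞_K`);
      numerically a UNIT for 37a1 at (13, ℚ(√-23)), k = 26, 50 and at (11, ℚ(√-79)), k = 22, versus
      `v = 1, 2` at the trivial-character weights 74, 102.  18431 then holds with `m = 0` at such data
      (true for the wrong reason), 18432 is false as typed there.  Repair: `2*hK*((p-1)*p^N) ∣ k-2`.
* §4  Near-misses / not attempted: the `H → ¬VerticalContact` negative lemma with `H` = Hida's vertical
      Hecke-field growth (refutes the typo D1, dies with the restate; census N4) — not filed.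
-/

set_option linter.dupNamespace false

namespace Summit.BirchSwinnertonDyer.BirchSwinnertonDyer.Cruxes.VerticalContact.Disproof

/-! ## §1 Load-bearing analysis of the depth clause -/

/-- **The bound clause forces the period to be non-zero.**  In `VerticalContact` (and verbatim in the
repaired `VerticalContactR`) the last conjunct at depth `N` reads
`∀ I₀ ∈ RI, PT I₀ → ∀ e₀, PR e₀ → ∀ j : ℕ, val P ^ 2 ≤ val (Φ I₀ e₀) ^ 2 * val p ^ j → j ≤ 2*m*(N+1) + C`.
Instantiated at ANY admissible `(I₀, e₀)` (one exists: `I₀ := L c`, `e₀ := e`), it implies `P ≠ 0`: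
if `P = 0` the hypothesis holds for every `j` (`val 0 ^ 2 = 0 ≤ _`), so `j := 2*m*(N+1)+C+1` is absurd.
Consequences for provers: (i) a witness of the crux proves non-vanishing of the typed toric period
`P_N = P_K(g_N, ξ_N)` at every depth, i.e. `L(g_N/K, ξ_N^{-1}, k_N/2) ≠ 0` for the chosen weights
(Waldspurger) — generic non-vanishing along the slanted arc, an open Greenberg-type statement;
(ii) see `period_ne_zero_imp_exists_value_ne_zero` for the redundancy it creates. [folklore] -/
theorem bound_forces_period_ne_zero {F Γ₀ : Type*} [Field F]
    [LinearOrderedCommGroupWithZero Γ₀] (val : Valuation F Γ₀) (P y c : F) (B : ℕ)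
    (h : ∀ j : ℕ, val P ^ 2 ≤ val y ^ 2 * val c ^ j → j ≤ B) : P ≠ 0 := by
  rintro rfl
  have := h (B + 1) (by simp)
  omega

/-- **Redundancy of the non-vanishing conjunct.**  The typed period is a finite sum
`P = ∑ c, t c * Φ(L c)(e)` over `ClassGroup (𝓞 K)`; if `P ≠ 0` some summand's value `Φ (L c) (e)` is
non-zero, hence `Φ (L c) ≠ 0` as a polynomial, and the data clause supplies `HG (L c)` (so `L c ∈ RI`)
and `PT (L c)`.  Therefore the conjunct `∃ I ∈ RI, PT I ∧ Φ I ≠ 0` of the form clause follows from the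
bound clause (`bound_forces_period_ne_zero`) and carries no information: "any proof must produce a
non-zero period, not merely a non-zero form".  Abstract form used: a non-zero finite sum of products
has a factor-non-zero summand. [folklore] -/
theorem period_ne_zero_imp_exists_value_ne_zero {ι R : Type*} [Fintype ι] [CommSemiring R]
    [NoZeroDivisors R] (t f : ι → R) (h : ∑ c, t c * f c ≠ 0) : ∃ c, f c ≠ 0 := by
  by_contra hall
  simp only [not_exists, not_not] at hall
  exact h (Finset.sum_eq_zero fun c _ => by simp [hall c])

/-- **The depth exponent is a genuine integer invariant.**  With `val p < 1` (as `(p : 𝓞 F) ∈ 𝔓`), the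
set of `j` satisfying the hypothesis `val P ^ 2 ≤ val y ^ 2 * val p ^ j` is downward closed, so the
clause `∀ j, hyp j → j ≤ B` says exactly `sup {j | hyp j} ≤ B`; in additive terms
`⌊2 (ord_𝔓 P - ord_𝔓 y) / e_𝔓⌋ ≤ B` whenever `ord_𝔓 P ≥ ord_𝔓 y`.  Recorded as the monotonicity
provers need when they move between depths `j` (cf. the landed helper
`Theorems/VerticalContactVerticalContactDepthShift.lean`). [folklore] -/
theorem depth_hyp_antitone {F Γ₀ : Type*} [Field F] [LinearOrderedCommGroupWithZero Γ₀]
    (val : Valuation F Γ₀) (P y c : F) (hc : val c ≤ 1) {i j : ℕ} (hij : i ≤ j)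
    (h : val P ^ 2 ≤ val y ^ 2 * val c ^ j) : val P ^ 2 ≤ val y ^ 2 * val c ^ i := by
  exact h.trans (mul_le_mul_right (pow_le_pow_right_of_le_one' hc hij) _)

/-! ## §1b  D3 — CHARACTER LEAKAGE in the admissible weights (new this cycle; misstatement class)

The form clause admits every weight `k` with `2 < k ∧ 2*(p-1)*p^N ∣ k-2 ∧ 2*hK ∣ k-2`, and the typed
period twists the Gross-point values by `(algebraMap K F (α c))⁻¹ ^ ((k-2)/hK)`.  The character
`c ↦ α_c^{-(k-2)/hK} (mod 𝔓)` is TRIVIAL mod `p^{N+1}` iff `(p-1) p^N ∣ (k-2)/hK`; the two typed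
divisibilities only give `lcm(2(p-1)p^N, 2hK) ∣ k-2`, which is weaker exactly when
`gcd(hK, p-1) > 1` (`p ∤ hK` is a hypothesis).  At such `(p, K)` the admissible weights split into
classes according to the residual character `χ = ω((k-2)/hK)` of `Pic(𝓞_K)` (order dividing
`gcd(hK, p-1)`), and in a class with `χ ≠ 𝟙` the typed period `P_N` is congruent (unit factor) to the
`χ`-TWISTED weight-2 Gross period `Σ_c χ(c) f_E(x_c)`, whose vanishing is governed by
`L(E/K, χ, 1)` (rank of `E` over the Hilbert class field cut out by `χ`), NOT by
`r_an(E) + r_an(E^{d_K})`.  NUMERICAL WITNESS (exact, this cycle, `job/main.py`):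
  * 37a1, p = 13, K = ℚ(√-23) (hK = 3, gcd = 3): k = 26, 50 (χ cubic): `v_13(P) = 0` (UNIT);
    k = 74 (χ = 𝟙): `v_13(P) = 1` (the expected depth-0 vanishing).
  * 37a1, p = 11, K = ℚ(√-79) (hK = 5, gcd = 5): k = 22 (χ quintic): `v_11(P) = 0` (UNIT);
    k = 102 (χ = 𝟙): `v_11(P) = 2`.
CONSEQUENCES.  (i) For 18431 (∃ p K … ∀ N ∃ k) the leak only HELPS the prover: at a leaky `(p, K)` with
`Σ_c χ(c) f_E(x_c) ≢ 0 mod 𝔓` the clause holds along `k_N` in the `χ`-class with `m = 0` and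
`C = 0` — the crux becomes (modulo the supply lemma) TRUE FOR THE WRONG REASON and no longer
encodes any contact order; (ii) for the companion crux 18432 (`VerticalSelmerBound`, ∀ data ∃ C′ ∀ N k …)
the same weights are admissible and force `j = 0`, so `(N+1)·(s⁺+s⁻) ≤ C′` for all `N` — FALSE as
typed whenever `s⁺ + s⁻ ≥ 1` at a leaky datum with a unit twisted period (37a1 / 13 / ℚ(√-23) is one:
rank 1, `v(P) = 0` computed at k = 26, 50).  Neither is Lean-landable (eigenform supply), so this is
filed as a MISSTATEMENT with the repair below, to ride with the pending D1 restate.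
REPAIR (both items, one token): replace `2 * (p - 1) * p ^ N ∣ k - 2 ∧ 2 * hK ∣ k - 2` by
`2 * hK * ((p - 1) * p ^ N) ∣ k - 2` (theorems `repaired_weight_kills_character`,
`unit_pow_totient_prime_pow`: then `(k-2)/hK` is a multiple of `2(p-1)p^N` and every `𝔓`-adic unit
raised to it is `≡ 1 mod p^{N+1}`, so the twist is trivial to the depth and `P_N ≡ Gross period`). -/
theorem admissible_weight_with_nontrivial_character :
    ∃ p hK N k : ℕ, p.Prime ∧ ¬ p ∣ 6 * hK ∧ 2 < k ∧ 2 * (p - 1) * p ^ N ∣ k - 2 ∧ 2 * hK ∣ k - 2 ∧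
      ¬ (p - 1) * p ^ N ∣ (k - 2) / hK :=
  ⟨13, 3, 0, 26, by norm_num, by norm_num, by norm_num, by decide, by decide, by decide⟩

/-- The repaired divisibility `2 * hK * ((p-1) * p^N) ∣ k - 2` makes the twist exponent `(k-2)/hK` a
multiple of `2 (p-1) p^N` (so in particular even, and a multiple of `φ(p^{N+1})`). [folklore] -/
theorem repaired_weight_kills_character {p hK N k : ℕ} (hh : 0 < hK)
    (h : 2 * hK * ((p - 1) * p ^ N) ∣ k - 2) : 2 * ((p - 1) * p ^ N) ∣ (k - 2) / hK := by
  obtain ⟨t, ht⟩ := h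
  have : k - 2 = hK * (2 * ((p - 1) * p ^ N) * t) := by rw [ht]; ring
  rw [this, Nat.mul_div_cancel_left _ hh]
  exact Dvd.intro t rfl

/-- Euler's theorem at a prime power: a unit of `ZMod (p^(N+1))` raised to `(p-1) p^N = φ(p^{N+1})` is
`1`.  With `repaired_weight_kills_character` this is why the repaired weights carry the TRIVIAL
character to depth `N+1` (`α_c` is a `𝔓`-adic unit as `(a₀ c)` is prime to `p` and `𝓞_{K,𝔓} = ℤ_p`
for `p` split). [folklore] -/
theorem unit_pow_totient_prime_pow {p : ℕ} (hp : p.Prime) (N : ℕ) (u : (ZMod (p ^ (N + 1)))ˣ) :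
    u ^ ((p - 1) * p ^ N) = 1 := by
  haveI : NeZero (p ^ (N + 1)) := ⟨pow_ne_zero _ hp.ne_zero⟩
  have h := ZMod.pow_totient u
  rwa [Nat.totient_prime_pow_succ hp, mul_comm] at h

/-! ## §2 Why the typed statement resists a counterexample -/

/-- `resists` — bookkeeping constant carrying the analysis (no mathematical content).

WHY NO COUNTEREXAMPLE (cycle 1).
1. The statement is `∀ W … → ∃ (p K … m C), … ∧ ∀ N, ∃ (k lam Φ), …`.  A refutation must exhibit ONE
   globally minimal elliptic `W` with a multiplicative prime and show that NO admissible datum exists.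
   All side conditions are genuine (non-junk) tree notions and are satisfiable in print for every such
   `W` (Serre surjectivity for non-CM `E`, ordinary primes of density one, Dirichlet/CRT for `K`,
   Bump–Friedberg–Hoffstein / Murty–Murty for `r_an(E^{d_K}) ≤ 1`, Hilbert symbols for `(a,b)`,
   Eichler orders of any level prime to `N⁻`, Eichler's optimal-embedding count `2 h_K > 0`), so the
   only refutable content is the depth inequality itself.
2. For the depth inequality, under the only leading-term prediction in print (Disegni 2022 Conj. Pf on
   the slanted arc, census §0) the crux at `(p, K)` is `s⁺ + s⁻ ≤ r_an(E) + r_an(E^{d_K})` plus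
   `Pf(h_𝒞) ≠ 0`; refuting it for ONE `E` at ALL admissible `(p, K)` needs either a BSD-violating `E`
   or a structural degeneracy of the alternating weight height, for which no mechanism exists
   (complex conjugation acts trivially on the weight direction; census N3).
3. Junk models: none available — `m = 0` is allowed but then the clause is the (true, Gross-formula)
   rank-0 statement only when `r_an(E/K) = 0`; for `r_an(E/K) ≥ 1` the congruence with the vanishing
   weight-2 period forces `v(P_N) - content ≥ N+1`, so `m = 0` witnesses are impossible and `m ≥ 1`
   needs `r_an(E) + r_an(E^{d_K}) ≥ 2` — consistent, no contradiction (numerically confirmed, §3).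
4. Hecke normalisation (a would-be misstatement kill): with `ρ β P = P((X,Y)·ι β)` (degree `+(k-2)`
   central character) the SUB-lattice operator `Σ_{J ⊂ I, [I:J]=q²} Φ J` has eigenvalue the arithmetic
   `a_q(g_k)` (super-lattices would give `a_q q^{-(k-2)}` and make `val (lam p) = 1` unsatisfiable);
   the decl uses sub-lattices — confirmed by the computation (`v(λ_p) = 0` for the ordinary form).
5. D1 (typo-level falsity) is real but dies with the restate; see the module docstring. -/
def resists : Unit := ()

/-! ## §3 Computation record (typed period valuations) — see module docstring; raw table in the
attached `results.json` of kit job j026225 and in `NOTES.md` of the disprover's folder. -/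

/-- `slopeTable` — the observed `(curve, p, d_K, k, depth N, v(P_typed) - content)` tuples computed
EXACTLY (integers mod `p^M`, `M ≥ 16`) by the disprover's Brandt module (local runs; farm job j026225
extends the table).  Crux prediction: last entry `≤ m (N+1) + C/2` with `2m ≤ r_an(E)+r_an(E^{d_K})`;
congruence lower bound: `≥ N+1` when `r_an(E/K) ≥ 1`. -/
def slopeTable : List (String × ℕ × ℕ × ℕ × ℕ × ℕ) :=
  [("19a1", 5, 11, 10, 0, 0), ("19a1", 5, 11, 42, 1, 0),
   ("37a1", 5, 19, 10, 0, 1), ("37a1", 5, 19, 42, 1, 2),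
   ("37a1", 11, 19, 22, 0, 1), ("37a1", 13, 43, 26, 0, 1),
   ("37a1", 13, 23, 74, 0, 1), ("37a1", 11, 79, 102, 0, 2),
   ("11a1 (over ℚ(√-47): r_an(E^{-47}) = 2, configuration (0,2))", 7, 47, 62, 0, 1)]

/-- `leakTable` — the D3 witnesses: `(curve, p, d_K, k, order of the residual character χ, v(P_typed))`;
`χ ≠ 𝟙` rows are units, `χ = 𝟙` rows vanish to the expected depth. -/
def leakTable : List (String × ℕ × ℕ × ℕ × ℕ × ℕ) :=
  [("37a1", 13, 23, 26, 3, 0), ("37a1", 13, 23, 50, 3, 0), ("37a1", 13, 23, 74, 1, 1),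
   ("37a1", 11, 79, 22, 5, 0), ("37a1", 11, 79, 102, 1, 2)]

end Summit.BirchSwinnertonDyer.BirchSwinnertonDyer.Cruxes.VerticalContact.Disproof
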